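import Literature.NumberTheory.Sieve.SingularSeries
import HarnessLib

/-!
# Discharged fact: the twin-prime singular series `𝔖({0, 2}) = 2 C₂`

`Literature.NumberTheory.Sieve.SingularSeries` defines the Hardy–Littlewood singular series of a
tuple `H` as an ordered Euler product, `Literature.singularSeries H = limUnder atTop (singularSeriesPartial H)`
with `singularSeriesPartial H x = ∏_{p ≤ x} (1 - ν_H(p)/p)(1 - 1/p)^{-k}` (`k = #H`), the twin prime
constant likewise, `Literature.twinPrimeConst = limUnder atTop twinPrimeConstPartial` with
`twinPrimeConstPartial x = ∏_{2 < p ≤ x} (1 - 1/(p-1)²)` (D-SIEVE-1), and records as a named fact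
(D-0014)

* `Literature.NumberTheory.Sieve.singularSeries_pair` : `singularSeries {0, 2} = 2 * twinPrimeConst` (`𝔖({0, 2}) = 2 C₂`).

It is proved here (`Literature.NumberTheory.Sieve.singularSeries_pair_holds`), together with the by-products
`Literature.NumberTheory.Sieve.singularSeriesPartial_pair` (the partial products agree up to the factor `2` from `x = 2` on),
`Literature.NumberTheory.Sieve.tendsto_twinPrimeConstPartial_div_two` and `Literature.NumberTheory.Sieve.twinPrimeConst_eq_singularSeries_pair_div_two`
(`C₂ = 𝔖({0, 2})/2`). The file only uses `Literature.NumberTheory.Sieve.SingularSeries` (the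
in-file discharges `tendsto_singularSeriesPartial_holds` and `tupleResidueCount_eq_card_of_lt_holds`);
the convergence and positivity facts `Literature.NumberTheory.Sieve.tendsto_twinPrimeConstPartial`, `Literature.NumberTheory.Sieve.twinPrimeConst_pos`
are discharged independently in the sibling `Literature.NumberTheory.Sieve.SingularSeriesProofs`.

Source check. Hardy–Littlewood 1923 introduce the constant `C₂ = ∏_{ϖ ≥ 3} (1 - 1/(ϖ-1)²)` with
Conjecture A ((4·11)–(4·12), p. 32) and state Conjecture B (p. 42): for every even `k` there are
infinitely many prime pairs `(p, p + k)`, and `P_k(n) ∼ 2 C₂ n/(log n)² ∏ (p-1)/(p-2)`, the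
product over the odd prime divisors `p` of `k`, "where `C₂` is the constant of §4"; for `k = 2`
this is (5·311) (p. 43), `P₂(n) ∼ 2 C₂ n/(log n)²`. In the `k`-tuple normalisation of
`Literature.NumberTheory.Sieve.SingularSeries` (Halberstam–Richert, *Sieve Methods*, ch. 10) the
constant of the pair `{0, 2}` is `𝔖({0, 2}) = ∏_p (1 - ν(p)/p)(1 - 1/p)^{-2}`, and the vendored
fact `Literature.singularSeries_pair : 𝔖({0, 2}) = 2 C₂` is the (correct, unweakened) identification
of the two normalisations; no correction is needed.

Proof. For `H = {0, 2}` one has `k = 2`, `ν_H(2) = 1` and `ν_H(p) = 2` for `p > 2`, so the Euler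
factor is `(1 - 1/2)(1 - 1/2)^{-2} = 2` at `p = 2` and
`(1 - 2/p)(1 - 1/p)^{-2} = p(p-2)/(p-1)² = 1 - 1/(p-1)²` at `p > 2`. Hence for `x ≥ 2` the ordered
partial products satisfy `∏_{p ≤ x} (…) = 2 ∏_{2 < p ≤ x} (1 - 1/(p-1)²)`
(`singularSeriesPartial_pair`). The left side converges to `𝔖({0, 2})`
(`tendsto_singularSeriesPartial_holds`), so the partial products of `C₂` converge to
`𝔖({0, 2})/2`; since `C₂` is *defined* as their ordered limit (`limUnder`), and `ℝ` is Hausdorff,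
`C₂ = 𝔖({0, 2})/2` (`Filter.Tendsto.limUnder_eq`), i.e. `𝔖({0, 2}) = 2 C₂`.

## References

* G. H. Hardy, J. E. Littlewood, *Some problems of 'Partitio Numerorum' III: On the expression of
  a number as a sum of primes*, Acta Math. 44 (1923), 1–70: (4·11)–(4·12) p. 32, Conjecture B
  p. 42, (5·311) p. 43. doi:10.1007/BF02403921. [HardyLittlewood1923]
* H. Halberstam, H.-E. Richert, *Sieve Methods*, Academic Press 1974, ch. 10 (the `k`-tuple
  singular series).
-/

noncomputable section

open Filter Finset
open scoped Topology

namespace Literature.NumberTheory.Sieve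

/-! ### The Euler factors of `𝔖({0, 2})` -/

/-- `ν_{{0,2}}(p) = 2` for `p > 2`: `0` and `2` are incongruent modulo `p`.
[cite: HardyLittlewood1923, Conjecture B] -/
theorem tupleResidueCount_pair_of_two_lt {p : ℕ} (hp : 2 < p) :
    tupleResidueCount ({0, 2} : Finset ℤ) p = 2 := by
  rw [tupleResidueCount_eq_card_of_lt_holds _ p]
  · rfl
  · intro a ha b hb
    simp only [Finset.mem_insert, Finset.mem_singleton] at ha hb
    rcases ha with rfl | rfl <;> rcases hb with rfl | rfl <;> (rw [abs_lt]; omega)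

/-- The Euler factor of `𝔖({0, 2})` at `p = 2` is `(1 - 1/2)(1 - 1/2)^{-2} = 2`, since
`ν_{{0,2}}(2) = 1` (both `0` and `2` are even). [cite: HardyLittlewood1923, Conjecture B] -/
theorem singularSeriesFactor_pair_two : singularSeriesFactor ({0, 2} : Finset ℤ) 2 = 2 := by
  rw [singularSeriesFactor, show tupleResidueCount ({0, 2} : Finset ℤ) 2 = 1 from by decide,
    show ({0, 2} : Finset ℤ).card = 2 from rfl]
  norm_num

/-- The Euler factor of `𝔖({0, 2})` at an odd prime (indeed at any `p > 2`) is
`(1 - 2/p)(1 - 1/p)^{-2} = 1 - 1/(p-1)²`, the factor of the twin prime constant `C₂` of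
Hardy–Littlewood 1923, (4·12) (p. 32). [cite: HardyLittlewood1923, eq. (4.12)] -/
theorem singularSeriesFactor_pair_of_two_lt {p : ℕ} (hp : 2 < p) :
    singularSeriesFactor ({0, 2} : Finset ℤ) p = 1 - 1 / ((p : ℝ) - 1) ^ 2 := by
  rw [singularSeriesFactor, tupleResidueCount_pair_of_two_lt hp,
    show ({0, 2} : Finset ℤ).card = 2 from rfl]
  have hp2 : (2 : ℝ) < p := by exact_mod_cast hp
  have hp0 : (p : ℝ) ≠ 0 := by positivity
  have hp1 : (p : ℝ) - 1 ≠ 0 := by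
    intro h
    linarith
  push_cast
  field_simp
  ring

/-! ### Partial products and the limit -/

/-- For `x ≥ 2` the ordered partial products of `𝔖({0, 2})` are twice those of `C₂`:
`∏_{p ≤ x} (1 - ν(p)/p)(1 - 1/p)^{-2} = 2 ∏_{2 < p ≤ x} (1 - 1/(p-1)²)`.
[cite: HardyLittlewood1923, Conjecture B] -/
theorem singularSeriesPartial_pair {x : ℕ} (hx : 2 ≤ x) :
    singularSeriesPartial ({0, 2} : Finset ℤ) x = 2 * twinPrimeConstPartial x := by
  rw [singularSeriesPartial, twinPrimeConstPartial]
  have h2 : 2 ∈ Nat.primesLE x := Nat.mem_primesLE.mpr ⟨hx, Nat.prime_two⟩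
  rw [← Finset.mul_prod_erase _ _ h2, singularSeriesFactor_pair_two]
  congr 1
  have herase : (Nat.primesLE x).erase 2 = (Nat.primesLE x).filter (2 < ·) := by
    ext p
    simp only [Finset.mem_erase, Finset.mem_filter, Nat.mem_primesLE]
    constructor
    · rintro ⟨hne, hpx, hp⟩
      exact ⟨⟨hpx, hp⟩, lt_of_le_of_ne hp.two_le (Ne.symm hne)⟩
    · rintro ⟨⟨hpx, hp⟩, h2p⟩
      exact ⟨h2p.ne', hpx, hp⟩
  rw [herase]
  refine Finset.prod_congr rfl fun p hp ↦ ?_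
  exact singularSeriesFactor_pair_of_two_lt (Finset.mem_filter.mp hp).2

/-- The partial products of `C₂` converge to `𝔖({0, 2}) / 2` (they are eventually half the
partial products of `𝔖({0, 2})`, which converge by `tendsto_singularSeriesPartial`).
[cite: HardyLittlewood1923, Conjecture B] -/
theorem tendsto_twinPrimeConstPartial_div_two :
    Tendsto twinPrimeConstPartial atTop (𝓝 (singularSeries ({0, 2} : Finset ℤ) / 2)) := by
  refine ((tendsto_singularSeriesPartial_holds ({0, 2} : Finset ℤ)).div_const 2).congr' ?_
  rw [EventuallyEq, eventually_atTop]
  refine ⟨2, fun x hx ↦ ?_⟩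
  rw [singularSeriesPartial_pair hx]
  ring

/-- `C₂ = 𝔖({0, 2}) / 2`: the ordered limit defining `C₂` is identified through
`tendsto_twinPrimeConstPartial_div_two` (Mathlib `Filter.Tendsto.limUnder_eq`).
Hardy–Littlewood 1923, (5·311) (p. 43). [cite: HardyLittlewood1923, eq. (5.311)] -/
theorem twinPrimeConst_eq_singularSeries_pair_div_two :
    twinPrimeConst = singularSeries ({0, 2} : Finset ℤ) / 2 := by
  rw [twinPrimeConst]
  exact tendsto_twinPrimeConstPartial_div_two.limUnder_eq

/-- **Discharge of `singularSeries_pair`**: `𝔖({0, 2}) = 2 C₂`, the constant of the twin prime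
asymptotic `P₂(n) ∼ 2 C₂ n/(log n)²`. Hardy–Littlewood 1923, Conjecture B (p. 42) and (5·311)
(p. 43); Halberstam–Richert, *Sieve Methods*, ch. 10. [cite: HardyLittlewood1923, Conjecture B] -/
theorem singularSeries_pair_holds : singularSeries_pair := by
  rw [singularSeries_pair, twinPrimeConst_eq_singularSeries_pair_div_two]
  ring

end Literature.NumberTheory.Sieve
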